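import Summits.HodgeConjecture.HodgeConjecture.Theses.HeckePrymWeil
import Literature.AlgebraicGeometry.Motives.AbelianVarietyProduct
import Literature.AlgebraicGeometry.Motives.AbelianVarietyProductDimProofs
import Literature.AlgebraicGeometry.Motives.HyperbolicWeilType
import Literature.AlgebraicGeometry.Motives.HyperbolicWeilTypeProduct
import Summits.HodgeConjecture.HodgeConjecture.Theorems.HeckePrymWeilWeilSixfoldsSqrtMinus7WeilSignatureOf
import Summits.HodgeConjecture.HodgeConjecture.Theorems.HeckePrymWeilWeilSixfoldsSqrtMinus7AimedPartnerOfParts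
import Summits.HodgeConjecture.HodgeConjecture.Theorems.HeckePrymWeilWeilSixfoldsSqrtMinus7HodgeRiemannOne
import Summits.HodgeConjecture.HodgeConjecture.Theorems.HeckePrymWeilWeilSixfoldsSqrtMinus7HyperplaneCalculusSym
import Summits.HodgeConjecture.HodgeConjecture.Theorems.HeckePrymWeilWeilSixfoldsSqrtMinus7BaseChangeModel
import Summits.HodgeConjecture.HodgeConjecture.Theorems.HeckePrymWeilWeilSixfoldsSqrtMinus7SplitFrameTransport
import Summits.HodgeConjecture.HodgeConjecture.Theorems.HeckePrymWeilWeilSixfoldsSqrtMinus7SplittingArithmetic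
import HarnessLib

/-!
# Route HeckePrymWeil · crux `WeilSixfoldsSqrtMinus7` (stmt-HodgeConjecture-1260) · line
# `real-quadratic-base-change` — planner STUB 2 `baseChangeSplitting`, UNCONDITIONAL

Lead c2 (`prover-line-stmt-HodgeConjecture-1260-c2-0`), 2026-08-16. With the three registered
sub-goals of the splitting LANDED — `stub_splittingArithmetic` (S2a, p121641), `stub_baseChangeModel`
(S2b, p121253), `stub_splitFrameTransport` (S2c, p120974), namespace
`…Theorems.WeilSixfoldsSqrtMinus7.RealQuadraticBaseChange` — this file proves the planner's STUB 2
of the line (registered as the sub-goal `baseChangeSplitting` of crux stmt-HodgeConjecture-1260):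

* `baseChangeSplitting`: every `ℚ(√-7)`-Weil-type sixfold `(A, φ)` (Weil type witnessed by a
  non-zero rational `(3,3)` class of its Weil plane) has a real quadratic field `F = ℚ(√t)` (`t > 0`
  NON-SQUARE), a projective embedding `e` of `A × A` and a rational `a ≠ 0` for which the base change
  `(A × A, ψ_K = φ × φ, ψ_F = ((x,y) ↦ (ty, x)))` carries a SPLIT FRAME — twelve rational,
  `ℂ`-independent classes of `H¹((A×A)(ℂ);ℂ)` spanning a `ψ_K^*`- and `ψ_F^*`-stable subspace,
  pairwise isotropic for `Q_{h,11}`, `h` the `L`-symmetrised hyperplane class of `(e, a)` — i.e.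
  `A ⊗ O_F` is of split (relatively hyperbolic) `L`-Weil type, `L = ℚ(√-7, √t)` (van Geemen LNM 1594
  Lemma 5.2 (1)–(3), 5.4; Markman arXiv:2509.23079 Lemma 8.3.4 (2) = Deligne–Milne; Landherr).
  Ingredients: line 1's G4′ (`stub_hyperplaneCalculusSym`: hyperplane generators) and G3
  (`stub_weilSignature_of`: the rational degree-one model WITH signature of `(A, φ, h_A)`, Hodge–Riemann
  in degree one), then S2a (arithmetic: `t`, the coefficient vectors), S2b (the model of the base change
  for this `t`), S2c (transport).

No definition, no named fact.
-/

noncomputable section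

-- single-problem summit (Problem = Summit): the mandated namespace repeats `HodgeConjecture`.
set_option linter.dupNamespace false

open CategoryTheory
open Literature.AlgebraicGeometry.Motives
open Literature.AlgebraicGeometry.HodgeTheory
open Literature.AlgebraicGeometry.Motives.AbelianVariety
open Literature.AlgebraicTopology.SingularHomology
open Literature.Geometry.Kaehler

namespace Summit.HodgeConjecture.HodgeConjecture.Theorems.WeilSixfoldsSqrtMinus7.RealQuadraticBaseChange

/-! ### Product bookkeeping: `A ⊗ O_F = A × A` is a 12-fold with commuting `ψ_K² = -7`, `ψ_F² = t` -/

/-- `dim (A × A) = 12` for a sixfold `A` (`AbelianVariety.dim_prod`). [folklore] -/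
theorem dim_prod_self_eq_twelve {A : AbelianVariety ℂ} (hA : A.dim = 6) : (A.prod A).dim = 12 := by
  rw [dim_prod]; omega

/-- `ψ_K ≫ ψ_K = -7` on `A × A` for `ψ_K = φ × φ` (componentwise, `prod_hom_ext`). [folklore] -/
theorem psiK_comp_psiK {A : AbelianVariety ℂ} {φ : A ⟶ A} (hφ : φ ≫ φ = -((7 : ℤ) • 𝟙 A)) :
    prodLift (fst A A ≫ φ) (snd A A ≫ φ) ≫ prodLift (fst A A ≫ φ) (snd A A ≫ φ) =
      -((7 : ℤ) • 𝟙 (A.prod A)) := by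
  apply prod_hom_ext
  · rw [Category.assoc, prodLift_fst, ← Category.assoc, prodLift_fst, Category.assoc, hφ]
    simp [Preadditive.comp_neg, Preadditive.neg_comp]
  · rw [Category.assoc, prodLift_snd, ← Category.assoc, prodLift_snd, Category.assoc, hφ]
    simp [Preadditive.comp_neg, Preadditive.neg_comp]

/-- `ψ_F ≫ ψ_F = t` on `A × A` for `ψ_F = ((x, y) ↦ (t·y, x))`. [folklore] -/
theorem psiF_comp_psiF (A : AbelianVariety ℂ) (t : ℕ) :
    prodLift ((t : ℤ) • snd A A) (fst A A) ≫ prodLift ((t : ℤ) • snd A A) (fst A A) =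
      (t : ℤ) • 𝟙 (A.prod A) := by
  apply prod_hom_ext
  · rw [Category.assoc, prodLift_fst, Preadditive.comp_zsmul, prodLift_snd, Preadditive.zsmul_comp,
      Category.id_comp]
  · rw [Category.assoc, prodLift_snd, prodLift_fst, Preadditive.zsmul_comp, Category.id_comp]

/-- `ψ_K ≫ ψ_F = ψ_F ≫ ψ_K` (`L = K·F` is commutative). [folklore] -/
theorem psiK_comm_psiF (A : AbelianVariety ℂ) (φ : A ⟶ A) (t : ℕ) :
    prodLift (fst A A ≫ φ) (snd A A ≫ φ) ≫ prodLift ((t : ℤ) • snd A A) (fst A A) =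
      prodLift ((t : ℤ) • snd A A) (fst A A) ≫ prodLift (fst A A ≫ φ) (snd A A ≫ φ) := by
  apply prod_hom_ext
  · rw [Category.assoc, prodLift_fst, Preadditive.comp_zsmul, prodLift_snd, Category.assoc,
      prodLift_fst, ← Category.assoc, prodLift_fst, Preadditive.zsmul_comp]
  · rw [Category.assoc, prodLift_snd, prodLift_fst, Category.assoc, prodLift_snd, ← Category.assoc,
      prodLift_snd]

/-! ### The splitting of the base change (planner STUB 2), unconditional -/

/-- Scaling a Gram matrix scales the isotropy sums: `Σ b (r•GG) b = r · Σ b GG b`. [folklore] -/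
theorem sum_mul_smul_matrix_mul' {ι κ : Type} [Fintype ι] (r : ℚ) (GG : Matrix ι ι ℚ) (b : κ → ι → ℚ)
    (k l : κ) :
    ∑ s, ∑ s', b k s * (r • GG) s s' * b l s' = r * ∑ s, ∑ s', b k s * GG s s' * b l s' := by
  simp only [Matrix.smul_apply, smul_eq_mul, Finset.mul_sum]
  refine Finset.sum_congr rfl fun s _ => Finset.sum_congr rfl fun s' _ => ?_
  ring

/-- **BASE-CHANGE SPLITTING** (planner STUB 2 of the line, unconditional): a sixfold `(A, φ)`,
`φ ≫ φ = -7`, carrying a NON-ZERO rational `(3,3)` class in its Weil plane admits `t > 0` non-square,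
a projective embedding `e` of `A × A` and a rational `a ≠ 0` with a SPLIT FRAME for
`(A × A, φ × φ, prodLift (t•snd) fst)` and the `L`-symmetrised hyperplane class of `(e, a)` — G4′
(hyperplane generators), an embedding `e_A` of `A`, G3 at `n = 3` (rational model WITH signature,
fed the Weil witness), S2a (arithmetic: `t`, `b`), S2b (model of the base change), S2c (transport).
[cite: vanGeemen1994HodgeAV, Lemma 5.2 (1)–(3) and 5.4 (5.4.1)] [cite: Markman2025SecantRealMultiplication, Lemma 8.3.4 (2)] -/
theorem baseChangeSplitting :
    ∀ (A : AbelianVariety ℂ) (φ : A ⟶ A), A.dim = 6 → φ ≫ φ = -((7 : ℤ) • 𝟙 A) →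
      (∃ c : complexBetti A.X 6, IsRationalClass c ∧ IsOfHodgeType 6 A.X 6 3 3 c ∧
        c ∈ Module.End.eigenspace (complexBetti.map (𝟙 A + φ).hom.hom.hom 6).hom
              ((1 + Complex.I * (Real.sqrt (7 : ℝ) : ℂ)) ^ 6) ⊔
            Module.End.eigenspace (complexBetti.map (𝟙 A + φ).hom.hom.hom 6).hom
              ((1 - Complex.I * (Real.sqrt (7 : ℝ) : ℂ)) ^ 6) ∧ c ≠ 0) →
      ∃ (t : ℕ) (e : ProjectiveEmbedding (A.prod A).X) (a : complexBetti (projectiveSpace e.n ℂ) 2),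
        0 < t ∧ ¬ IsSquare t ∧ IsRationalClass a ∧ a ≠ 0 ∧
        ∃ u : Fin 12 → complexBetti (A.prod A).X 1,
          (∀ i, IsRationalClass (u i)) ∧ LinearIndependent ℂ u ∧
          (∀ i, complexBetti.map (prodLift (fst A A ≫ φ) (snd A A ≫ φ)).hom.hom.hom 1 (u i) ∈
            Submodule.span ℂ (Set.range u)) ∧
          (∀ i, complexBetti.map (prodLift ((t : ℤ) • snd A A) (fst A A)).hom.hom.hom 1 (u i) ∈
            Submodule.span ℂ (Set.range u)) ∧
          ∀ i j, polarizationPairingOne (A.prod A).X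
              ((7 : ℂ) • (((t : ℂ) • complexBetti.map e.ι 2 a +
                  complexBetti.map (prodLift ((t : ℤ) • snd A A) (fst A A)).hom.hom.hom 2
                    (complexBetti.map e.ι 2 a))) +
                complexBetti.map (prodLift (fst A A ≫ φ) (snd A A ≫ φ)).hom.hom.hom 2
                  ((t : ℂ) • complexBetti.map e.ι 2 a +
                    complexBetti.map (prodLift ((t : ℤ) • snd A A) (fst A A)).hom.hom.hom 2
                      (complexBetti.map e.ι 2 a)))
              11 (u i) (u j) = 0 := by
  intro A φ hA hφ hwit
  obtain ⟨c, hrat, hH, hW, hc⟩ := hwit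
  classical
  -- G4′: hyperplane generators
  obtain ⟨g, hg_rat, hg_ne, hg_dim, -, -, -, -⟩ :=
    Summit.HodgeConjecture.HodgeConjecture.Theorems.WeilSixfoldsSqrtMinus7.HyperbolicEightfoldDescent.stub_hyperplaneCalculusSym
  -- an embedding of `A` and the class `a = g`
  obtain ⟨eA⟩ : Nonempty (ProjectiveEmbedding A.X) :=
    ⟨(AbelianVariety.isSmoothProjective_holds (A := A)).isProjectiveOver.projectiveEmbedding⟩
  have heAn : 1 ≤ eA.n := hg_dim A eA (by omega)
  have haA : IsRationalClass (g eA.n) := hg_rat eA.n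
  have haA0 : g eA.n ≠ 0 := hg_ne eA.n heAn
  -- G3 at `n = 3`: the rational degree-one model WITH signature
  have hA' : A.dim = 2 * 3 := by rw [hA]
  obtain ⟨u, M, G, ω, d₀, hu_rat, hu_ind, hu_span, hM, -, -, hG, hd₀, hM2, hGt, hGM, hPN⟩ :=
    Summit.HodgeConjecture.HodgeConjecture.Theorems.WeilSixfoldsSqrtMinus7.HyperbolicEightfoldDescent.stub_weilSignature_of
      (Summit.HodgeConjecture.HodgeConjecture.Theorems.WeilSixfoldsSqrtMinus7.HyperbolicEightfoldDescent.hodgeRiemannOne_symmetrised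
        Summit.HodgeConjecture.HodgeConjecture.Theorems.WeilSixfoldsSqrtMinus7.HyperbolicEightfoldDescent.stub_hodgeRiemannOne
        Summit.HodgeConjecture.HodgeConjecture.Theorems.WeilSixfoldsSqrtMinus7.HyperbolicEightfoldDescent.stub_hyperplaneCalculusSym)
      3 A φ (by norm_num) hA' hφ ⟨c, hc, hrat, hH, hW⟩ eA (g eA.n) haA haA0
  -- 2a: the arithmetic (`Fin (4 * 3)` is `Fin 12` definitionally)
  obtain ⟨t, b, ht, hsq, hb, hbM, hbΨ, hbG⟩ := stub_splittingArithmetic M G hM2 hGt hGM hPN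
  -- 2b: the model of the base change for this `t`
  obtain ⟨e, a', r, Ω, ha', ha'0, hwK, hwF, hQ⟩ :=
    stub_baseChangeModel A φ hA hφ eA (g eA.n) haA haA0 u M G ω d₀ hu_rat hu_ind hu_span hM hG hd₀ t ht
  -- 2c: transport
  refine ⟨t, e, a', ht, hsq, ha', ha'0, ?_⟩
  refine stub_splitFrameTransport (A.prod A) _ _ _ _ (Matrix.fromBlocks M 0 0 M)
    (Matrix.fromBlocks (0 : Matrix (Fin 12) (Fin 12) ℚ) 1 ((t : ℚ) • (1 : Matrix (Fin 12) (Fin 12) ℚ)) 0)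
    (r • Matrix.fromBlocks ((t : ℚ) • G) 0 0 G) Ω ?_ ?_ hwK hwF ?_ b hb hbM hbΨ ?_
  · rintro (i | i)
    · exact (hu_rat i).map _
    · exact (hu_rat i).map _
  · exact linearIndependent_sumElim_map_fst_map_snd hu_ind hu_ind
  · intro k l
    rw [hQ k l, Matrix.smul_apply, smul_eq_mul]
  · intro k l
    rw [sum_mul_smul_matrix_mul', hbG k l, mul_zero]


end Summit.HodgeConjecture.HodgeConjecture.Theorems.WeilSixfoldsSqrtMinus7.RealQuadraticBaseChange

end
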